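import Summits.Ventures.DiscreteObjects.PP12.OrderElevenTriangleRunsA
import Summits.Ventures.DiscreteObjects.PP12.OrderElevenTriangleRunsB
import Summits.Ventures.DiscreteObjects.PP12.OrderElevenTriangleRunsC
import Summits.Ventures.DiscreteObjects.PP12.OrderElevenTriangleRunsD
import Summits.Ventures.DiscreteObjects.PP12.OrderElevenTriangleRunsE
import Summits.Ventures.DiscreteObjects.PP12.OrderElevenTriangleRunsF
import Summits.Ventures.DiscreteObjects.PP12.OrderElevenTriangleCompat
import Summits.Ventures.DiscreteObjects.PP12.OrderElevenTrianglePhi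
import Summits.Ventures.DiscreteObjects.PP12.OrderElevenTrianglePhiWalk
import Summits.Ventures.DiscreteObjects.PP12.OrderElevenTriangleWalkMain

/-!
# PP(12), order-11 cell, Case B: **`NoTriangleData12` is a kernel theorem** — assembly of the certificate (designs g23)
Framing: lottery ticket; floor = certified bounds/negative ranges.

Cell pub-namedobj (venture DiscreteObjects), target (M). `NoTriangleData12` (`OrderElevenCollineation`, FAMILY-B1P §3; in print a case of Janko–van Trung,
Geom. Dedicata 12 (1982) 101–110, there by computer): no Case-B data `D : TriangleData 11` — a projective plane of order 12 with a collineation of order 11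
fixing exactly a triangle — are `Valid`. Proof (all in the kernel):
1. `normalize` (re-base the third pencil) gives valid data with `φ 0 = 0` (`OrderElevenTriangleSymmetry`);
2. the φ-walker runs `pwalk_v` (`OrderElevenTriangleRunsF`) list ALL normalised orthomorphisms (`pwalk_complete`, `OrderElevenTrianglePhiWalk`), and the word
   checks `tab_v` carry each, by validity-preserving generators (`applyWD_spec`, `OrderElevenTrianglePhi`), to one of the 11 representatives `REPS`;
3. for a representative `P`: every row of valid data with packed map `P` is listed by the label walker (`rowCode_mem_rowsFrom`, `OrderElevenTriangleWalkMain` / `WalkSound` / `LabelSound`;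
   `partsEnum_eq`, `rows_eq_k`, `OrderElevenTriangleRunsA–C`), rows of distinct orbits are `compat` (`compat_rowCode`), so row `0` would have ten compatible
   listed partners — but the scans `scan_k_lo_hi` (`OrderElevenTriangleRunsD/E`) say no listed row has ten (`noValid_of_scan`, `OrderElevenTriangleCompat`).
Main results: `noValid_normalised`, **`noTriangleData12 : NoTriangleData12`**. With `Homology12.noHomologyArray12` (Case A, designs g22, landing) this closes
`NoCollineationOfOrderEleven`, the p = 11 cell of `CollineationGroupIsTwoThreeGroup`. No `sorry`, no axioms beyond the standard three.
-/

set_option maxRecDepth 100000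

namespace Summit.Ventures.DiscreteObjects.PP12

namespace Triangle12

open Function TriangleData

/-- **per-representative refutation**: the walker equation, the scan and the two soundness theorems leave no valid data with packed map `P` -/
theorem noValid_of_rep {P : ℕ} {rows : List ℕ} (hrows : rowsFrom P PARTS = rows) (hscan : ∀ a ∈ rows, rowOK rows a = true)
    (D : TriangleData 11) (hV : D.Valid) (hP : packPhi D.phi = P) : False :=
  noValid_of_scan D rows hscan hV fun s => by
    rw [← hrows, ← hP, ← partsEnum_eq]; exact rowCode_mem_rowsFrom D hV s

/-! ### the orbit reduction -/

/-- **valid normalised data are carried by a generator word to valid data whose packed `φ` is the representative named by a table entry**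
(given a table slice that the walker consumes exactly for `v = φ 1` and whose words check out) -/
theorem exists_rep_of_table (D : TriangleData 11) (hV : D.Valid) (h0 : D.phi 0 = 0) (reps L : List ℕ)
    (hw : pwalkFrom (D.phi 1).val L = true) (ht : tabOK reps L = true) :
    ∃ E ∈ L, ∃ D' : TriangleData 11, D'.Valid ∧ D'.phi 0 = 0 ∧ packPhi D'.phi = reps.getD ((E >>> 44) &&& 15) 0 := by
  have hinj : Injective D.phi := fun a b e => hV.1.1 a b e
  have hdinj : Injective fun t => t - D.phi t := fun a b e => hV.1.2 a b e
  obtain ⟨E, hE, hEq⟩ := pwalk_complete hinj hdinj h0 hw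
  obtain ⟨a, b, c⟩ := applyWD_spec 20 (E >>> 48) D hV h0
  exact ⟨E, hE, _, a, b, by rw [c, ← hEq, tabOK_sound ht hE]⟩


/-- **the eleven representatives are refuted** (index `k < 16` as read from a table entry; `k ≥ 11` cannot occur: the default `0` is no packed injective map) -/
theorem noValid_reps (k : ℕ) (hk : k < 16) (D : TriangleData 11) (hV : D.Valid) (hP : packPhi D.phi = REPS.getD k 0) : False := by
  have hinj : Injective D.phi := fun a b e => hV.1.1 a b e
  interval_cases k
  · exact noValid_of_rep rows_eq_0 (scan_cover2 scan_0_0_6 scan_0_6_16) D hV (hP.trans rfl)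
  · exact noValid_of_rep rows_eq_1 (scan_cover2 scan_1_0_6 scan_1_6_16) D hV (hP.trans rfl)
  · exact noValid_of_rep rows_eq_2 (scan_cover2 scan_2_0_6 scan_2_6_16) D hV (hP.trans rfl)
  · exact noValid_of_rep rows_eq_3 (scan_cover3 scan_3_0_4 scan_3_4_8 scan_3_8_16) D hV (hP.trans rfl)
  · exact noValid_of_rep rows_eq_4 (scan_cover2 scan_4_0_6 scan_4_6_16) D hV (hP.trans rfl)
  · exact noValid_of_rep rows_eq_5 (scan_cover2 scan_5_0_6 scan_5_6_16) D hV (hP.trans rfl)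
  · exact noValid_of_rep rows_eq_6 (scan_cover2 scan_6_0_6 scan_6_6_16) D hV (hP.trans rfl)
  · exact noValid_of_rep rows_eq_7 (scan_cover2 scan_7_0_6 scan_7_6_16) D hV (hP.trans rfl)
  · exact noValid_of_rep rows_eq_8 (scan_cover2 scan_8_0_6 scan_8_6_16) D hV (hP.trans rfl)
  · exact noValid_of_rep rows_eq_9 (scan_cover2 scan_9_0_6 scan_9_6_16) D hV (hP.trans rfl)
  · exact noValid_of_rep rows_eq_10 (scan_cover4 scan_10_0_3 scan_10_3_6 scan_10_6_9 scan_10_9_16) D hV (hP.trans rfl)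
  · exact packPhi_ne_zero D.phi hinj (hP.trans rfl)
  · exact packPhi_ne_zero D.phi hinj (hP.trans rfl)
  · exact packPhi_ne_zero D.phi hinj (hP.trans rfl)
  · exact packPhi_ne_zero D.phi hinj (hP.trans rfl)
  · exact packPhi_ne_zero D.phi hinj (hP.trans rfl)

/-- one table slice finishes the argument -/
theorem finish (D : TriangleData 11) (hV : D.Valid) (h0 : D.phi 0 = 0) (L : List ℕ) (hw : pwalkFrom (D.phi 1).val L = true)
    (ht : tabOK REPS L = true) : False := by
  obtain ⟨E, -, D', hV', -, hP'⟩ := exists_rep_of_table D hV h0 REPS L hw ht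
  exact noValid_reps _ (lt_of_le_of_lt Nat.and_le_right (by norm_num)) D' hV' hP'

/-- **no valid normalised triangle data** -/
theorem noValid_normalised (D : TriangleData 11) (hV : D.Valid) (h0 : D.phi 0 = 0) : False := by
  have hinj : Injective D.phi := fun a b e => hV.1.1 a b e
  have hdinj : Injective fun t => t - D.phi t := fun a b e => hV.1.2 a b e
  have h1 : (D.phi 1).val ≠ 0 := fun e => by
    have : D.phi 1 = D.phi 0 := by rw [h0]; exact Fin.ext e
    exact absurd (hinj this) (by decide)
  have h2 : (D.phi 1).val ≠ 1 := fun e => by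
    have : (fun t => t - D.phi t) 1 = (fun t => t - D.phi t) 0 := by
      show (1 : Fin 11) - D.phi 1 = 0 - D.phi 0
      rw [h0, show D.phi 1 = 1 from Fin.ext e]; decide
    exact absurd (hdinj this) (by decide)
  obtain ⟨v, hv⟩ : ∃ v, (D.phi 1).val = v := ⟨_, rfl⟩
  have hv2 : 2 ≤ v := by omega
  have hv11 : v < 11 := hv ▸ (D.phi 1).isLt
  interval_cases v
  · exact finish D hV h0 PHITAB2 (by rw [hv]; exact pwalk_2) tab_2
  · exact finish D hV h0 PHITAB3 (by rw [hv]; exact pwalk_3) tab_3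
  · exact finish D hV h0 PHITAB4 (by rw [hv]; exact pwalk_4) tab_4
  · exact finish D hV h0 PHITAB5 (by rw [hv]; exact pwalk_5) tab_5
  · exact finish D hV h0 PHITAB6 (by rw [hv]; exact pwalk_6) tab_6
  · exact finish D hV h0 PHITAB7 (by rw [hv]; exact pwalk_7) tab_7
  · exact finish D hV h0 PHITAB8 (by rw [hv]; exact pwalk_8) tab_8
  · exact finish D hV h0 PHITAB9 (by rw [hv]; exact pwalk_9) tab_9
  · exact finish D hV h0 PHITAB10 (by rw [hv]; exact pwalk_10) tab_10

/-- **Case B of the order-11 cell of PP(12) is closed in the kernel: `NoTriangleData12`.** No projective plane of order 12 admits a collineation of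
order 11 fixing exactly a triangle (normal form of FAMILY-B1P §3; Janko–van Trung 1982 by computer; here by a kernel-checked certificate). -/
theorem noTriangleData12 : NoTriangleData12 := fun D hD =>
  noValid_normalised D.normalize (D.normalize_valid hD) D.normalize_phi_zero

end Triangle12

end Summit.Ventures.DiscreteObjects.PP12
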